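import Summits.Ventures.HodgeRepro2.T6A2WeilCoproduct
import Summits.Ventures.HodgeRepro2.HostAPI.Carriers.AlgebraicGeometry.Motives.AbelianVariety

/-!
# T6A2WeilGroupLaw — the group-law datum of the A2 situation from the host's `MonObj` structure

Cell pub-hodge-repro2, Tier 6 (README §10), seat t6-p2 (A2 host side). The datum `GroupLaw D` of
T6A2WeilCoproduct (a unit `e : pt → B` with `m ∘ (id, e) = id = m ∘ (e, id)`) is supplied by the host's
`AbelianVariety` through its monoid-object structure: `e := η[A.X]` (`MonObj.one`) and `m := μ[A.X]`
(`MonObj.mul`), the unit laws being `MonObj.mul_one` / `MonObj.one_mul` read through the cartesian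
structure (`(ρ_ X).inv = lift (𝟙 X) (toUnit X)`, `X ◁ η = lift fst (snd ≫ η)`). So for a situation with
`D.m = μ[A.X]`, `GroupLaw.ofAbelianVariety` is a theorem-level construction: no datum beyond the host's own
`AbelianVariety` is needed. No `sorry`; standard axioms. §8(d): uses an L-value-free non-vanishing device: NO.
-/

noncomputable section

namespace Summit.Ventures.HodgeRepro2.T6.WeilInst

open HostAPI.Carriers.AlgebraicGeometry.Motives CategoryTheory MonoidalCategory CartesianMonoidalCategory
open scoped MonObj

variable {k : Type} [Field k]

/-- the unit laws of a monoid object in the cartesian form: `lift (𝟙 X) (toUnit X ≫ η) ≫ μ = 𝟙 X` -/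
theorem lift_id_one_comp_mul (X : SchemeOver k) [MonObj X] :
    lift (𝟙 X) (toUnit X ≫ η[X]) ≫ μ[X] = 𝟙 X := by
  have h : lift (𝟙 X) (toUnit X ≫ η[X]) = (ρ_ X).inv ≫ (X ◁ η[X]) := by
    rw [← lift_whiskerLeft]
    congr 1
  rw [h, Category.assoc, MonObj.mul_one, Iso.inv_hom_id]

/-- the unit laws of a monoid object in the cartesian form: `lift (toUnit X ≫ η) (𝟙 X) ≫ μ = 𝟙 X` -/
theorem lift_one_id_comp_mul (X : SchemeOver k) [MonObj X] :
    lift (toUnit X ≫ η[X]) (𝟙 X) ≫ μ[X] = 𝟙 X := by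
  have h : lift (toUnit X ≫ η[X]) (𝟙 X) = (λ_ X).inv ≫ (η[X] ▷ X) := by
    rw [← lift_whiskerRight]
    congr 1
  rw [h, Category.assoc, MonObj.one_mul, Iso.inv_hom_id]

/-- THE GROUP LAW OF THE A2 SITUATION FROM THE HOST'S MONOID-OBJECT STRUCTURE: when the situation's addition
is the monoid multiplication `μ[D.B.X]` (the host's `AbelianVariety` makes `D.B.X` a group object, hence a
monoid object), its unit `η[D.B.X]` and the `MonObj` unit laws give the `GroupLaw` datum of T6A2WeilCoproduct. -/
def GroupLaw.ofMonObj (D : SituationData k) [MonObj D.B.X] (hm : D.m = μ[D.B.X]) : GroupLaw D where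
  e := η[D.B.X]
  unit_right := by rw [hm]; exact lift_id_one_comp_mul D.B.X
  unit_left := by rw [hm]; exact lift_one_id_comp_mul D.B.X

end Summit.Ventures.HodgeRepro2.T6.WeilInst

end
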